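import Literature.IUT.HodgeTheaters.GlobalFrobenioidsCyclotomeIsoOfIntegralLawsNonVacuity
import Literature.AnabelianGeometry.EtaleTheta.CyclotomeZHatSign
import HarnessLib

/-!
# [IUTchI] Example 5.1 (v), p. 128, second display — the `†𝕄^⊛`-case cyclotome rigidity AT THE TREE'S REAL
# CYCLOTOME `Ẑ` AND ITS REAL AUTOMORPHISM TORSOR `Ẑ^× = Aut(Ẑ)` (proof-only; FACT-LIST F-2577 / F-2003 / F-2582)

S. Mochizuki, *Inter-universal Teichmüller theory I*, kurims manuscript (May 2020), §5 Example 5.1 (v), p. 127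
l. 75 – p. 128 l. 49 ([IUTchI] Ex 5.1 (v) pp.127–128) [claim: Mochizuki2012, status: disputed]: "from the elementary
observation that, relative to the natural inclusion `ℚ ↪ Ẑ ⊗ ℚ`, `ℚ_{>0} ∩ Ẑ^× = {1}` … there exists a unique
isomorphism of cyclotomes `μ^Θ_Ẑ(π₁(†𝒟^⊚)) ⥲ μ_Ẑ(†𝕄^⊛)` such that the resulting isomorphism between direct limits of
cohomology modules induces isomorphisms `𝕄^⊛(†𝒟^⊚) ⥲ †𝕄^⊛`, `𝕄^⊛_sol(†𝒟^⊚) ⥲ †𝕄^⊛_sol`, `𝕄^⊛_mod(†𝒟^⊚) ⥲ †𝕄^⊛_mod`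
… in a fashion that is compatible with the integral submonoids `𝒪^⊿_𝔭`".  Classical input: `Ẑ = lim ℤ/nℤ`
[RibesZalesskii2010, Thm 2.7.1] (the tree's REAL `Ẑ`, `Ẑ^× = Aut(Ẑ)`, `−1 ∈ Ẑ^×`: `CyclotomeZHatAction.lean`,
`CyclotomeZHatSign.lean`, `GlobalFrobenioidsCyclotomeRigidityZHat.lean` — imported, nothing restated).

PROOF-ONLY companion (theorems only: no `def`, no `instance`, no `structure`, no new `Prop` fact) of abc-iut-L5-t1's
`GlobalFrobenioidsCyclotomes.lean` (F-2577 `UniqueCyclotomeIsoFamily`, F-2003 `CyclotomeComparisonFamily.InducesCompatibleIsos`)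
and `GlobalFrobenioidsKummer.lean` (F-2582 `UniqueCyclotomeIso`).  Cell abc-iut, FACT-LIST tranche 189 (abc-iut-f-189).

**State before this file.**  The three rows are SCHEMAS over the free interface record `CyclotomeComparisonFamily`
(universal closures REFUTED, `GlobalFrobenioidsCyclotomesNonVacuity.lean`); their kernel witnesses so far live at TOYS whose
torsor of cyclotome isomorphisms is `Aut(ℤ) = {±1}` (`exists_uniqueCyclotomeIsoFamily_valuationToy`) or TRIVIAL
(`exists_family_of_integral_laws_hypotheses`: cyclotomes `:= PUnit`, so "uniqueness of the isomorphism" is vacuous there);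
the closers of record `UniqueCyclotomeIsoFamily.of_integral_laws` (p427568) / `of_laws` / `of_valuation` bind F-2003 only as
`hex : ∃ e, C.InducesCompatibleIsos e`; the arithmetic `ℚ_{>0} ∩ Ẑ^× = {1}` is a theorem about the REAL `Aut(Ẑ)`
(`CyclotomeRigidity.eq_one_of_pos_of_nonneg`, `eq_one_of_two_zeros_one_pole`).

**What this file adds** — the instance forms AT THE REAL CYCLOTOME, i.e. with the `∃!` ranging over the genuine,
infinite torsor `Ẑ^×` instead of `{±1}` or `{1}`:
* §1, the two printed observations as EXACT descriptions of subsets of the real `Ẑ^× = Aut(Ẑ)`: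
  `CyclotomeRigidity.bijOn_range_eta_iff` — **`ℚ^× ∩ Ẑ^× = {±1}`**: `u ∈ Aut(Ẑ)` maps the lattice `η(ℤ) ⊆ Ẑ` [the
  Kummer classes of a multiplicative GROUP of constants, read through one valuation] onto itself iff `u = ±1`;
  `CyclotomeRigidity.bijOn_cone_iff` / `mapsTo_cone_iff` — **`ℚ_{>0} ∩ Ẑ^× = {1}`**: `u` maps the cone `η(ℤ_{≥0})`
  [the classes integral at `𝔭`, `𝒪^⊿_𝔭`] into itself iff `u = 1`; `negOneAut_not_mapsTo_cone` (`−1` fails).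
* §2, `CyclotomeComparisonFamily.exists_zhatModel` — the comparison family of the display with BOTH cyclotomes the real
  `Ẑ` (so `μ₁ ≃* μ₂` IS `Aut(Ẑ) = Ẑ^×`), containers `Ẑ` [one valuation coordinate `ord_𝔭` of `lim_H H¹(H, Ẑ(1)) ⊇ F^×`],
  every layer `⊛ / sol / mod := η(ℤ)` [a GROUP layer, as `F̄^×`, `F_sol^×`, `F_mod^×` are groups], every `𝒪^⊿_𝔭 := η(ℤ_{≥0})`,
  induced map = the automorphism acting: (F-2003) `InducesCompatibleIsos e` holds for EXACTLY ONE `e ∈ Ẑ^×`;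
  (F-2577) **`UniqueCyclotomeIsoFamily` HOLDS**; (F-2582) at every single layer EXACTLY TWO isomorphisms (`±1`) pass the
  layer clause, so `UniqueCyclotomeIso (C.component i)` FAILS for every `i` — at genuine `Ẑ^×` the one-layer route
  `UniqueCyclotomeIsoFamily.of_component` (hypothesis `huniq`) cannot fire on group layers; the printed clause
  "compatible with the integral submonoids `𝒪^⊿_𝔭`" is what pins the isomorphism.
* `CyclotomeComparisonFamily.exists_zhatModel_integral_laws` — at the same family ALL hypotheses (E)(T)(V)(I)(P) of the
  closer of record `UniqueCyclotomeIsoFamily.of_integral_laws` hold with the GENUINE torsor law (T) `e′ = (e′e⁻¹)·e`,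
  `twist u = u`, and the closer fires (non-degenerate joint satisfiability: the earlier witness had `μ := PUnit`).
* (v2) `CyclotomeComparison.exists_zhatModel_uniqueCyclotomeIso` — F-2582's one-layer form HOLDS at the real `Ẑ^×` when the
  layer is the PSEUDO-MONOID shadow `η(ℤ_{>0})` (orders at a zero of `κ`-coric functions, not inversion-closed;
  `CyclotomeRigidity.bijOn_posCone_iff`), in contrast with the group layers of §2.
* `CyclotomeComparisonFamily.exists_zhatModel_not_unique_of_isEmpty` — with NO prime (`𝔓` empty: no `𝒪^⊿` constraint)
  the same genuine data satisfy the such-that clause for both `±1`: F-2577's universal closure is refuted at REAL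
  cyclotome data too, and the integral clause is load-bearing.
HONEST LABELS: GENUINE cyclotome / torsor / rigidity side (`Ẑ`, `Ẑ^×`, level characters); DEGENERATE container side (one
valuation coordinate in place of `lim_H H¹`, the three layers coincide).  Bookkeeping consequence only: F-2577 / F-2003 /
F-2582 stay SCHEMAS, now model-witnessed at the real `Ẑ^×`; nothing of [IUTchI] is asserted or denied; no side is taken
on [IUTchIII] Cor. 3.12; typed ≠ proved; instantiated ≠ endorsed.
-/

namespace Literature.IUT.HodgeTheaters

open ProfiniteGrp ProfiniteGrp.ProfiniteCompletion
open Literature.AnabelianGeometry.EtaleTheta Literature.AnabelianGeometry.EtaleTheta.ZHatLevel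

universe w w'

/-! ### §1 `ℚ^× ∩ Ẑ^× = {±1}` and `ℚ_{>0} ∩ Ẑ^× = {1}` as subsets of the real `Aut(Ẑ)` -/

namespace CyclotomeRigidity

variable (u : MulAut (completion (GrpCat.of (Multiplicative ℤ))))

/-- `η(−d) = η(d)⁻¹` in `Ẑ`. ([IUTchI] Ex 5.1 (v) p.128) [claim: Mochizuki2012, status: disputed] -/
theorem eta_neg (d : ℤ) : eta (-d) = (eta d)⁻¹ := by
  rw [eta_eq_zpow d, eta_eq_zpow (-d), zpow_neg]

/-- `−1 ∈ Ẑ^×` acts on the integers `η(ℤ) ⊆ Ẑ` by `d ↦ −d`. ([IUTchI] Ex 5.1 (v) p.128)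
[claim: Mochizuki2012, status: disputed] -/
theorem negOneAut_apply_eta (d : ℤ) : negOneAut (eta d) = eta (-d) := by
  rw [negOneAut_apply, eta_neg]

/-- `(−1)⁻¹ = −1` in `Ẑ^×`. ([IUTchI] Ex 5.1 (v) p.128) [claim: Mochizuki2012, status: disputed] -/
theorem negOneAut_inv : negOneAut⁻¹ = negOneAut :=
  inv_eq_of_mul_eq_one_right negOneAut_mul_self

/-- **`ℚ^× ∩ Ẑ^× = {±1}`, torsor form**: an element of `Ẑ^× = Aut(Ẑ)` carrying `η(1)` to an integer `η(d′)` is `±1`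
(abc-iut-w4-d056's `eq_or_eq_neg_of_apply_eta`: `d′ = ±1`; then `u`, resp. `(−1)·u`, fixes `η(1)`, hence is `1` by
`eq_one_of_apply_eta_self`). ([IUTchI] Ex 5.1 (v) p.128) [claim: Mochizuki2012, status: disputed] -/
theorem eq_one_or_eq_negOneAut_of_apply_eta_one {d' : ℤ} (h : u (eta 1) = eta d') :
    u = 1 ∨ u = negOneAut := by
  rcases eq_or_eq_neg_of_apply_eta u one_ne_zero h with h1 | h1
  · subst h1
    exact Or.inl (eq_one_of_apply_eta_self u one_ne_zero h)
  · subst h1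
    refine Or.inr ?_
    have h2 : (negOneAut * u) (eta 1) = eta 1 := by
      rw [MulAut.mul_apply, h, negOneAut_apply_eta, neg_neg]
    have h3 : negOneAut * u = 1 := eq_one_of_apply_eta_self _ one_ne_zero h2
    rw [eq_inv_of_mul_eq_one_right h3, negOneAut_inv]

/-- **`ℚ^× ∩ Ẑ^× = {±1}`**: `u ∈ Aut(Ẑ)` maps the lattice of integers `η(ℤ)` [valuations at `𝔭` of the Kummer classes of a
multiplicative group of constants] into itself iff `u = ±1`. ([IUTchI] Ex 5.1 (v) p.128)
[claim: Mochizuki2012, status: disputed] -/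
theorem mapsTo_range_eta_iff :
    Set.MapsTo u (Set.range eta) (Set.range eta) ↔ u = 1 ∨ u = negOneAut := by
  constructor
  · intro h
    obtain ⟨d', hd'⟩ := h ⟨1, rfl⟩
    exact eq_one_or_eq_negOneAut_of_apply_eta_one u hd'.symm
  · rintro (rfl | rfl)
    · intro x hx
      rwa [MulAut.one_apply]
    · rintro _ ⟨d, rfl⟩
      exact ⟨-d, (negOneAut_apply_eta d).symm⟩

/-- **`ℚ^× ∩ Ẑ^× = {±1}`, bijective form**: `u ∈ Aut(Ẑ)` maps `η(ℤ)` BIJECTIVELY onto itself iff `u = ±1` — the layer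
clause of the display alone, read on a group layer through one valuation, leaves exactly two isomorphisms.
([IUTchI] Ex 5.1 (v) p.128) [claim: Mochizuki2012, status: disputed] -/
theorem bijOn_range_eta_iff :
    Set.BijOn u (Set.range eta) (Set.range eta) ↔ u = 1 ∨ u = negOneAut := by
  refine ⟨fun h => (mapsTo_range_eta_iff u).1 h.mapsTo, ?_⟩
  rintro (rfl | rfl)
  · exact (Set.bijOn_id _).congr fun x _ => (MulAut.one_apply _ x).symm
  · refine ⟨(mapsTo_range_eta_iff negOneAut).2 (Or.inr rfl), negOneAut.injective.injOn, ?_⟩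
    rintro _ ⟨d, rfl⟩
    exact ⟨eta (-d), ⟨-d, rfl⟩, by rw [negOneAut_apply_eta, neg_neg]⟩

/-- **`ℚ_{>0} ∩ Ẑ^× = {1}`, cone form**: `u ∈ Aut(Ẑ)` maps the cone `η(ℤ_{≥0})` [the classes integral at `𝔭`: `𝒪^⊿_𝔭`
read through `ord_𝔭`] into itself iff `u = 1` (abc-iut-w4-d057's `eq_one_of_pos_of_nonneg` at `d = 1`).
([IUTchI] Ex 5.1 (v) p.128) [claim: Mochizuki2012, status: disputed] -/
theorem mapsTo_cone_iff :
    Set.MapsTo u (eta '' {d : ℤ | 0 ≤ d}) (eta '' {d : ℤ | 0 ≤ d}) ↔ u = 1 := by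
  constructor
  · intro h
    obtain ⟨d', hd'0, hd'⟩ := h ⟨1, show (0 : ℤ) ≤ 1 by norm_num, rfl⟩
    exact eq_one_of_pos_of_nonneg u one_pos hd'0 hd'.symm
  · rintro rfl x hx
    rwa [MulAut.one_apply]

/-- **`ℚ_{>0} ∩ Ẑ^× = {1}`, bijective form**: `u ∈ Aut(Ẑ)` maps `η(ℤ_{≥0})` bijectively onto itself iff `u = 1`.
([IUTchI] Ex 5.1 (v) p.128) [claim: Mochizuki2012, status: disputed] -/
theorem bijOn_cone_iff :
    Set.BijOn u (eta '' {d : ℤ | 0 ≤ d}) (eta '' {d : ℤ | 0 ≤ d}) ↔ u = 1 := by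
  refine ⟨fun h => (mapsTo_cone_iff u).1 h.mapsTo, ?_⟩
  rintro rfl
  exact (Set.bijOn_id _).congr fun x _ => (MulAut.one_apply _ x).symm

/-- `−1 ∈ Ẑ^×` is NOT compatible with the integral cone (`η(1) ↦ η(−1) ∉ η(ℤ_{≥0})`).
([IUTchI] Ex 5.1 (v) p.128) [claim: Mochizuki2012, status: disputed] -/
theorem negOneAut_not_mapsTo_cone :
    ¬ Set.MapsTo negOneAut (eta '' {d : ℤ | 0 ≤ d}) (eta '' {d : ℤ | 0 ≤ d}) := fun h =>
  negOneAut_ne_one ((mapsTo_cone_iff negOneAut).1 h)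

end CyclotomeRigidity

/-! ### §2 The display's comparison family at the real cyclotome `Ẑ` -/

namespace CyclotomeComparisonFamily

open CyclotomeRigidity

/-- **Ex. 5.1 (v), p. 128, second display, AT THE REAL CYCLOTOME** (`μ₁ = μ₂ = Ẑ`, torsor of isomorphisms `= Ẑ^×`;
containers `Ẑ` = one valuation coordinate; layers `η(ℤ)`; `𝒪^⊿_𝔭 = η(ℤ_{≥0})` for every `𝔭 ∈ 𝔓 ≠ ∅`; induced map = the
automorphism acting): (F-2003) the such-that clause `InducesCompatibleIsos` holds for exactly one `e ∈ Ẑ^×`;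
(F-2582) at every single layer EXACTLY TWO isomorphisms pass the layer clause — one of them violating the integral clause —
so `UniqueCyclotomeIso (C.component i)` FAILS for every layer `i` [the hypothesis `huniq` of
`UniqueCyclotomeIsoFamily.of_component` is unavailable at genuine `Ẑ^×` on group layers]; (F-2577)
**`UniqueCyclotomeIsoFamily C` HOLDS** — pinned by "compatible with the integral submonoids `𝒪^⊿_𝔭`", i.e. by
`ℚ_{>0} ∩ Ẑ^× = {1}`.  GENUINE cyclotome side, DEGENERATE container side; SCHEMA evidence for the FACT-LIST rows.
([IUTchI] Ex 5.1 (v) p.128) [claim: Mochizuki2012, status: disputed] -/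
theorem exists_zhatModel (ι : Type w) (𝔓 : Type w') [Nonempty 𝔓] :
    ∃ C : CyclotomeComparisonFamily ι 𝔓,
      (C.μ₁ = completion (GrpCat.of (Multiplicative ℤ)) ∧ C.μ₂ = completion (GrpCat.of (Multiplicative ℤ)) ∧
        C.H₁ = completion (GrpCat.of (Multiplicative ℤ)) ∧ C.H₂ = completion (GrpCat.of (Multiplicative ℤ))) ∧
      (∃! e : C.μ₁ ≃* C.μ₂, C.InducesCompatibleIsos e) ∧
      (∀ i : ι, ∃ e₁ e₂ : C.μ₁ ≃* C.μ₂, e₁ ≠ e₂ ∧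
        Set.BijOn (C.induced e₁) (C.im₁ i) (C.im₂ i) ∧ Set.BijOn (C.induced e₂) (C.im₁ i) (C.im₂ i) ∧
        C.InducesCompatibleIsos e₁ ∧ ¬ C.InducesCompatibleIsos e₂ ∧
        ∀ e : C.μ₁ ≃* C.μ₂, Set.BijOn (C.induced e) (C.im₁ i) (C.im₂ i) → e = e₁ ∨ e = e₂) ∧
      (∀ i : ι, ¬ UniqueCyclotomeIso (C.component i)) ∧
      UniqueCyclotomeIsoFamily C := by
  obtain ⟨𝔭₀⟩ := ‹Nonempty 𝔓›
  let zhatCommGroup : CommGroup (completion (GrpCat.of (Multiplicative ℤ))) :=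
    { (inferInstance : Group (completion (GrpCat.of (Multiplicative ℤ)))) with
      mul_comm := Literature.AnabelianGeometry.AbsoluteAnabelian.ZHatCompletion.mul_comm }
  let C : CyclotomeComparisonFamily ι 𝔓 :=
    { μ₁ := completion (GrpCat.of (Multiplicative ℤ)), μ₂ := completion (GrpCat.of (Multiplicative ℤ)),
      grp₁ := zhatCommGroup, grp₂ := zhatCommGroup,
      H₁ := completion (GrpCat.of (Multiplicative ℤ)), H₂ := completion (GrpCat.of (Multiplicative ℤ)),
      im₁ := fun _ => Set.range eta, im₂ := fun _ => Set.range eta,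
      int₁ := fun _ => eta '' {d : ℤ | 0 ≤ d}, int₂ := fun _ => eta '' {d : ℤ | 0 ≤ d},
      induced := fun e h => e h }
  -- the isomorphisms of cyclotomes of `C` ARE the elements of `Ẑ^× = Aut(Ẑ)`
  let ofAut : MulAut (completion (GrpCat.of (Multiplicative ℤ))) → (C.μ₁ ≃* C.μ₂) := fun u => u
  have hclause : ∀ e : C.μ₁ ≃* C.μ₂, C.InducesCompatibleIsos e ↔ e = ofAut 1 := by
    intro e
    constructor
    · intro he
      exact (bijOn_cone_iff e).1 (he.2 𝔭₀)
    · rintro rfl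
      exact ⟨fun _ => (bijOn_range_eta_iff 1).2 (Or.inl rfl), fun _ => (bijOn_cone_iff 1).2 rfl⟩
  have hlayer : ∀ (i : ι) (e : C.μ₁ ≃* C.μ₂),
      Set.BijOn (C.induced e) (C.im₁ i) (C.im₂ i) ↔ e = ofAut 1 ∨ e = ofAut negOneAut :=
    fun _ e => bijOn_range_eta_iff e
  have hne : ofAut 1 ≠ ofAut negOneAut := fun h => negOneAut_ne_one h.symm
  refine ⟨C, ⟨rfl, rfl, rfl, rfl⟩, ⟨ofAut 1, (hclause _).2 rfl, fun e he => (hclause e).1 he⟩, ?_, ?_,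
    ⟨⟨ofAut 1, (hclause _).2 rfl, fun e he => (hclause e).1 he⟩⟩⟩
  · intro i
    refine ⟨ofAut 1, ofAut negOneAut, hne, (hlayer i _).2 (Or.inl rfl), (hlayer i _).2 (Or.inr rfl),
      (hclause _).2 rfl, fun h => hne ((hclause _).1 h).symm, fun e he => (hlayer i e).1 he⟩
  · intro i huniq
    obtain ⟨e, -, he⟩ := huniq.existsUnique
    have h1 : ofAut 1 = e := he _ ((hlayer i _).2 (Or.inl rfl))
    have h2 : ofAut negOneAut = e := he _ ((hlayer i _).2 (Or.inr rfl))
    exact hne (h1.trans h2.symm)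

/-- **The closer of record fires at the genuine torsor.**  At the family of `exists_zhatModel` every hypothesis of
abc-iut-w4-d057's `UniqueCyclotomeIsoFamily.of_integral_laws` holds with the GENUINE simply-transitive action of `Ẑ^×` on
the isomorphisms of cyclotomes — `zμ u e := u·e`, law (T) witnessed by `u := e′e⁻¹`, container action `twist u := u`,
`val_𝔭 := η⁻¹` — and the theorem yields `UniqueCyclotomeIsoFamily` (compare `exists_family_of_integral_laws_hypotheses`,
where the cyclotomes are `PUnit` and (T) is degenerate). ([IUTchI] Ex 5.1 (v) p.128) [claim: Mochizuki2012, status: disputed] -/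
theorem exists_zhatModel_integral_laws (ι : Type w) (𝔓 : Type w') [Nonempty 𝔓] (i₀ : ι) :
    ∃ (C : CyclotomeComparisonFamily ι 𝔓)
      (zμ : MulAut (completion (GrpCat.of (Multiplicative ℤ))) → (C.μ₁ ≃* C.μ₂) → (C.μ₁ ≃* C.μ₂))
      (twist : MulAut (completion (GrpCat.of (Multiplicative ℤ))) → C.H₂ → C.H₂)
      (val : 𝔓 → C.H₂ → ℤ),
      (C.μ₁ = completion (GrpCat.of (Multiplicative ℤ)) ∧ C.μ₂ = completion (GrpCat.of (Multiplicative ℤ))) ∧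
      (∀ e, zμ 1 e = e) ∧
      (∃ e, C.InducesCompatibleIsos e) ∧
      (∀ e e' : C.μ₁ ≃* C.μ₂, ∃ u : MulAut (completion (GrpCat.of (Multiplicative ℤ))),
        e' = zμ u e ∧ ∀ h, C.induced e' h = twist u (C.induced e h)) ∧
      (∀ u : MulAut (completion (GrpCat.of (Multiplicative ℤ))),
        Set.MapsTo (twist u) (C.im₂ i₀) (C.im₂ i₀) →
          ∀ h ∈ C.im₂ i₀, ∀ 𝔭 : 𝔓, u (eta (val 𝔭 h)) = eta (val 𝔭 (twist u h))) ∧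
      (∀ 𝔭 : 𝔓, ∀ h ∈ C.im₂ i₀, h ∈ C.int₂ 𝔭 → 0 ≤ val 𝔭 h) ∧
      (∃ 𝔭₁ : 𝔓, ∃ h ∈ C.im₂ i₀, h ∈ C.int₂ 𝔭₁ ∧ 0 < val 𝔭₁ h) ∧
      (∃ e e' : C.μ₁ ≃* C.μ₂, e ≠ e') ∧
      UniqueCyclotomeIsoFamily C := by
  classical
  obtain ⟨𝔭₀⟩ := ‹Nonempty 𝔓›
  -- the valuation coordinate: `val (η d) = d`, `0` off `η(ℤ)`
  let val : completion (GrpCat.of (Multiplicative ℤ)) → ℤ :=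
    fun h => if hh : h ∈ Set.range eta then hh.choose else 0
  have hval_eta : ∀ d : ℤ, val (eta d) = d := by
    intro d
    have hh : eta d ∈ Set.range eta := ⟨d, rfl⟩
    have h1 : val (eta d) = hh.choose := dif_pos hh
    rw [h1]
    exact CyclotomeIsoIntegralLawsToy.eta_injective hh.choose_spec
  let zhatCommGroup : CommGroup (completion (GrpCat.of (Multiplicative ℤ))) :=
    { (inferInstance : Group (completion (GrpCat.of (Multiplicative ℤ)))) with
      mul_comm := Literature.AnabelianGeometry.AbsoluteAnabelian.ZHatCompletion.mul_comm }
  let C : CyclotomeComparisonFamily ι 𝔓 :=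
    { μ₁ := completion (GrpCat.of (Multiplicative ℤ)), μ₂ := completion (GrpCat.of (Multiplicative ℤ)),
      grp₁ := zhatCommGroup, grp₂ := zhatCommGroup,
      H₁ := completion (GrpCat.of (Multiplicative ℤ)), H₂ := completion (GrpCat.of (Multiplicative ℤ)),
      im₁ := fun _ => Set.range eta, im₂ := fun _ => Set.range eta,
      int₁ := fun _ => eta '' {d : ℤ | 0 ≤ d}, int₂ := fun _ => eta '' {d : ℤ | 0 ≤ d},
      induced := fun e h => e h }
  let ofAut : MulAut (completion (GrpCat.of (Multiplicative ℤ))) → (C.μ₁ ≃* C.μ₂) := fun u => u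
  let toAut : (C.μ₁ ≃* C.μ₂) → MulAut (completion (GrpCat.of (Multiplicative ℤ))) := fun e => e
  have hex : ∃ e, C.InducesCompatibleIsos e :=
    ⟨ofAut 1, fun _ => (bijOn_range_eta_iff 1).2 (Or.inl rfl), fun _ => (bijOn_cone_iff 1).2 rfl⟩
  have htors : ∀ e e' : C.μ₁ ≃* C.μ₂, ∃ u : MulAut (completion (GrpCat.of (Multiplicative ℤ))),
      e' = ofAut (u * toAut e) ∧ ∀ h, C.induced e' h = u (C.induced e h) := by
    intro e e'
    refine ⟨toAut e' * (toAut e)⁻¹, (inv_mul_cancel_right (toAut e') (toAut e)).symm, fun h => ?_⟩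
    change e' h = (toAut e' * (toAut e)⁻¹) (e h)
    rw [MulAut.mul_apply, MulAut.inv_apply_self]
  have hval : ∀ u : MulAut (completion (GrpCat.of (Multiplicative ℤ))),
      Set.MapsTo u (C.im₂ i₀) (C.im₂ i₀) →
        ∀ h ∈ C.im₂ i₀, ∀ 𝔭 : 𝔓, u (eta (val h)) = eta (val (u h)) := by
    rintro u hu h ⟨d, rfl⟩ -
    obtain ⟨d', hd'⟩ := hu ⟨d, rfl⟩
    have hd'' : eta d' = u (eta d) := hd'
    rw [hval_eta, ← hd'', hval_eta]
  have hint : ∀ 𝔭 : 𝔓, ∀ h ∈ C.im₂ i₀, h ∈ C.int₂ 𝔭 → 0 ≤ val h := by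
    rintro - h - ⟨d, hd, rfl⟩
    rw [hval_eta]; exact hd
  have hpos : ∃ 𝔭₁ : 𝔓, ∃ h ∈ C.im₂ i₀, h ∈ C.int₂ 𝔭₁ ∧ 0 < val h :=
    ⟨𝔭₀, eta 1, ⟨1, rfl⟩, ⟨1, by norm_num, rfl⟩, by rw [hval_eta]; exact one_pos⟩
  refine ⟨C, fun u e => ofAut (u * toAut e), fun u h => u h, fun _ => val, ⟨rfl, rfl⟩, fun e => one_mul (toAut e),
    hex, htors, hval, hint, hpos, ⟨ofAut 1, ofAut negOneAut, fun h => negOneAut_ne_one h.symm⟩, ?_⟩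
  exact UniqueCyclotomeIsoFamily.of_integral_laws C i₀ (fun u e => ofAut (u * toAut e)) (fun e => one_mul (toAut e))
    (fun u h => u h) hex htors (fun _ => val) hval hint hpos

/-- **No prime, no rigidity — at genuine data too.**  With `𝔓` EMPTY (no integral submonoid constrains) the same
genuine family satisfies the such-that clause for BOTH `±1 ∈ Ẑ^×` and for nothing else: `InducesCompatibleIsos` is
inhabited, `UniqueCyclotomeIsoFamily` FAILS.  So F-2577's universal closure is refuted at REAL cyclotome data (not only
at the `Aut(ℤ) = {±1}` toy), and the clause "compatible with the integral submonoids `𝒪^⊿_𝔭`" is load-bearing.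
([IUTchI] Ex 5.1 (v) p.128) [claim: Mochizuki2012, status: disputed] -/
theorem exists_zhatModel_not_unique_of_isEmpty (ι : Type w) (𝔓 : Type w') [Nonempty ι] [IsEmpty 𝔓] :
    ∃ C : CyclotomeComparisonFamily ι 𝔓,
      (C.μ₁ = completion (GrpCat.of (Multiplicative ℤ)) ∧ C.μ₂ = completion (GrpCat.of (Multiplicative ℤ))) ∧
      (∃ e₁ e₂ : C.μ₁ ≃* C.μ₂, e₁ ≠ e₂ ∧ C.InducesCompatibleIsos e₁ ∧ C.InducesCompatibleIsos e₂ ∧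
        ∀ e, C.InducesCompatibleIsos e → e = e₁ ∨ e = e₂) ∧
      ¬ UniqueCyclotomeIsoFamily C := by
  obtain ⟨i₀⟩ := ‹Nonempty ι›
  let zhatCommGroup : CommGroup (completion (GrpCat.of (Multiplicative ℤ))) :=
    { (inferInstance : Group (completion (GrpCat.of (Multiplicative ℤ)))) with
      mul_comm := Literature.AnabelianGeometry.AbsoluteAnabelian.ZHatCompletion.mul_comm }
  let C : CyclotomeComparisonFamily ι 𝔓 :=
    { μ₁ := completion (GrpCat.of (Multiplicative ℤ)), μ₂ := completion (GrpCat.of (Multiplicative ℤ)),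
      grp₁ := zhatCommGroup, grp₂ := zhatCommGroup,
      H₁ := completion (GrpCat.of (Multiplicative ℤ)), H₂ := completion (GrpCat.of (Multiplicative ℤ)),
      im₁ := fun _ => Set.range eta, im₂ := fun _ => Set.range eta,
      int₁ := fun 𝔭 => isEmptyElim 𝔭, int₂ := fun 𝔭 => isEmptyElim 𝔭,
      induced := fun e h => e h }
  let ofAut : MulAut (completion (GrpCat.of (Multiplicative ℤ))) → (C.μ₁ ≃* C.μ₂) := fun u => u
  have hclause : ∀ e : C.μ₁ ≃* C.μ₂, C.InducesCompatibleIsos e ↔ e = ofAut 1 ∨ e = ofAut negOneAut := by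
    intro e
    constructor
    · intro he
      exact (bijOn_range_eta_iff e).1 (he.1 i₀)
    · rintro (rfl | rfl)
      · exact ⟨fun _ => (bijOn_range_eta_iff 1).2 (Or.inl rfl), fun 𝔭 => isEmptyElim 𝔭⟩
      · exact ⟨fun _ => (bijOn_range_eta_iff negOneAut).2 (Or.inr rfl), fun 𝔭 => isEmptyElim 𝔭⟩
  have hne : ofAut 1 ≠ ofAut negOneAut := fun h => negOneAut_ne_one h.symm
  refine ⟨C, ⟨rfl, rfl⟩, ⟨ofAut 1, ofAut negOneAut, hne, (hclause _).2 (Or.inl rfl), (hclause _).2 (Or.inr rfl),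
    fun e he => (hclause e).1 he⟩, ?_⟩
  rintro ⟨⟨e, -, huniq⟩⟩
  have h1 : ofAut 1 = e := huniq _ ((hclause _).2 (Or.inl rfl))
  have h2 : ofAut negOneAut = e := huniq _ ((hclause _).2 (Or.inr rfl))
  exact hne (h1.trans h2.symm)

end CyclotomeComparisonFamily

/-! ### §3 (v2, append-only) The one-layer form F-2582 `UniqueCyclotomeIso` at the real cyclotome: a PSEUDO-MONOID
layer versus a group layer -/

namespace CyclotomeRigidity

variable (u : MulAut (completion (GrpCat.of (Multiplicative ℤ))))

/-- **`ℚ_{>0} ∩ Ẑ^× = {1}`, strict-cone form**: `u ∈ Aut(Ẑ)` maps the strict cone `η(ℤ_{>0})` [the orders AT A ZERO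
of the Kummer classes of a pseudo-monoid of `κ`-coric rational functions: positive, Rmk 3.1.7 (i); the layer is NOT
closed under inversion] into itself iff `u = 1`. ([IUTchI] Ex 5.1 (v) p.128) [claim: Mochizuki2012, status: disputed] -/
theorem mapsTo_posCone_iff :
    Set.MapsTo u (eta '' {d : ℤ | 0 < d}) (eta '' {d : ℤ | 0 < d}) ↔ u = 1 := by
  constructor
  · intro h
    obtain ⟨d', hd'0, hd'⟩ := h ⟨1, show (0 : ℤ) < 1 by norm_num, rfl⟩
    exact eq_one_of_pos_of_nonneg u one_pos (le_of_lt hd'0) hd'.symm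
  · rintro rfl x hx
    rwa [MulAut.one_apply]

/-- Bijective form of `mapsTo_posCone_iff`. ([IUTchI] Ex 5.1 (v) p.128) [claim: Mochizuki2012, status: disputed] -/
theorem bijOn_posCone_iff :
    Set.BijOn u (eta '' {d : ℤ | 0 < d}) (eta '' {d : ℤ | 0 < d}) ↔ u = 1 := by
  refine ⟨fun h => (mapsTo_posCone_iff u).1 h.mapsTo, ?_⟩
  rintro rfl
  exact (Set.bijOn_id _).congr fun x _ => (MulAut.one_apply _ x).symm

end CyclotomeRigidity

namespace CyclotomeComparison

open CyclotomeRigidity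

/-- **Ex. 5.1 (v), p. 127 l. 75 – p. 128 l. 24, first display (`𝕄^⊛_∞κ`), AT THE REAL CYCLOTOME — F-2582.**  For the
one-layer comparison with both cyclotomes the tree's `Ẑ` (torsor of isomorphisms `= Ẑ^×`), container `Ẑ` [the valuation
coordinate at ONE ZERO of the Kummer classes] and layer `η(ℤ_{>0})` [the image of a PSEUDO-MONOID of `κ`-coric rational
functions: orders at a zero are positive and the layer is not inversion-closed, Rmk 3.1.7 (i)], **`UniqueCyclotomeIso`
HOLDS**: exactly one `e ∈ Ẑ^×` (namely `1`) maps the layer onto itself — by `ℚ_{>0} ∩ Ẑ^× = {1}`.  Contrast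
`CyclotomeComparisonFamily.exists_zhatModel`: on a GROUP layer `η(ℤ)` the same genuine torsor leaves `±1` and the
one-layer form fails.  GENUINE cyclotome side, DEGENERATE container side; SCHEMA evidence for the FACT-LIST row F-2582.
([IUTchI] Ex 5.1 (v) p.128) [claim: Mochizuki2012, status: disputed] -/
theorem exists_zhatModel_uniqueCyclotomeIso :
    ∃ C : CyclotomeComparison,
      (C.μ₁ = completion (GrpCat.of (Multiplicative ℤ)) ∧ C.μ₂ = completion (GrpCat.of (Multiplicative ℤ)) ∧
        C.H₁ = completion (GrpCat.of (Multiplicative ℤ)) ∧ C.H₂ = completion (GrpCat.of (Multiplicative ℤ))) ∧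
      (∃ e e' : C.μ₁ ≃* C.μ₂, e ≠ e') ∧
      UniqueCyclotomeIso C := by
  let zhatCommGroup : CommGroup (completion (GrpCat.of (Multiplicative ℤ))) :=
    { (inferInstance : Group (completion (GrpCat.of (Multiplicative ℤ)))) with
      mul_comm := Literature.AnabelianGeometry.AbsoluteAnabelian.ZHatCompletion.mul_comm }
  let C : CyclotomeComparison :=
    { μ₁ := completion (GrpCat.of (Multiplicative ℤ)), μ₂ := completion (GrpCat.of (Multiplicative ℤ)),
      grp₁ := zhatCommGroup, grp₂ := zhatCommGroup,
      H₁ := completion (GrpCat.of (Multiplicative ℤ)), H₂ := completion (GrpCat.of (Multiplicative ℤ)),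
      im₁ := eta '' {d : ℤ | 0 < d}, im₂ := eta '' {d : ℤ | 0 < d},
      induced := fun e h => e h }
  let ofAut : MulAut (completion (GrpCat.of (Multiplicative ℤ))) → (C.μ₁ ≃* C.μ₂) := fun u => u
  have hlayer : ∀ e : C.μ₁ ≃* C.μ₂, Set.BijOn (C.induced e) C.im₁ C.im₂ ↔ e = ofAut 1 :=
    fun e => bijOn_posCone_iff e
  refine ⟨C, ⟨rfl, rfl, rfl, rfl⟩, ⟨ofAut 1, ofAut negOneAut, fun h => negOneAut_ne_one h.symm⟩,
    ⟨⟨ofAut 1, (hlayer _).2 rfl, fun e he => (hlayer e).1 he⟩⟩⟩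

end CyclotomeComparison

end Literature.IUT.HodgeTheaters
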